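import Summits.ValiantsHypothesis.ValiantsHypothesis.Theorems.RigidityForcesSymmetryGrenetFirstOrderRankRigidGapBlocks

/-!
# Route RigidityForcesSymmetry — `GrenetFirstOrderRankRigid` (item stmt-ValiantsHypothesis-21029),
line `grenet_gauge`: stub `stub_linearRigid`, step 5 (blocks III / I<, part 4) — the border cases

For the crux line `Cruxes/GrenetFirstOrderRankRigid/Lines/grenet_gauge.lean` (blueprint
`Lines/grenet_gauge-stub_linearRigid-PROOF.md`, §5; interface `Lines/grenet_gauge-stub_linearRigid-BLOCKS.md`,
deliverables (D-Q0), (D-P0)).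

* `grenet_gap_Q0` — a tail entry whose column vertex is `univ` (type III, `k = |F|`: no head partner)
  vanishes: at the gap design of an ordering listing `R i` then `v.1` (all high columns inactive) only
  this entry survives in its weight block;
* `grenet_gap_P0` — a head entry whose row vertex is `∅` (type III, `k = 0`: no tail partner) vanishes:
  at the design of an ordering listing `C j - v.1` then `v.1` on the columns `≥ |C j| - 1` only this entry
  survives;
* `grenet_III_PQ`, `grenet_III_tail`, `grenet_III_head`, `grenet_III_Q0`, `grenet_III_P0` and
  `grenet_Ilt_PQ`, `grenet_Ilt_tail`, `grenet_Ilt_head` — the deliverables with the TYPE hypotheses of the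
  interface (III: `U ⊆ T`; I<: `|U \ T| < |T \ U|`), reduced to the gap theorems of `…GapBlocks`
  (`|U| < |T|`; for III the strictness comes from genuineness).

No new definitions.  VP ≠ VNP is not moved by this file (first-order bookkeeping about one matrix
family).
-/

noncomputable section

open MvPolynomial Matrix Finset

namespace Summit.ValiantsHypothesis.Theorems.RigidityForcesSymmetry.GrenetGauge

open Literature.Computability.AlgebraicComplexity

/-! ### Border case `T = univ`: a lone tail entry vanishes -/

section BorderQ0

variable {k : Type*} [CommRing k] [IsDomain k] {n N : ℕ} (e : Finset (Fin n) ≃ Fin (N + 1))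

/-- **(D-Q0).**  A tail entry `(i, j, v)` (`v = (p, |R i|)`, `p ∉ R i`) of a homogeneous tangent direction at
Grenet's pencil whose column vertex is `C j = univ`, with `|R i + p| < n`, vanishes: `A'_v i j = 0` (its
weight block, evaluated at the gap design of an ordering listing `R i` then `p`, with every column
`> |R i|` inactive, contains no other surviving entry). [cite: Grenet2011, Thm. 1] -/
theorem grenet_gap_Q0 (hn : n ≠ 0) (hN : 2 ^ n = N + 1)
    (A' : Fin n × Fin n → Matrix (Fin N) (Fin N) k)
    (htr : ((Grenet.repr k n e).adjugate * ∑ v, (X v : MvPolynomial (Fin n × Fin n) k) • (A' v).map C).trace = 0)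
    {i j : Fin N} {v : Fin n × Fin n}
    (htail : v.1 ∉ e.symm ((e univ).succAbove i) ∧ (v.2 : ℕ) = (e.symm ((e univ).succAbove i)).card)
    (hTu : e.symm ((e ∅).succAbove j) = univ)
    (hUn : (insert v.1 (e.symm ((e univ).succAbove i))).card < n) :
    A' v i j = 0 := by
  classical
  -- notation and bookkeeping
  set S := e.symm ((e univ).succAbove i) with hSdef
  set T := e.symm ((e ∅).succAbove j) with hTdef
  have hRinj : ∀ a b : Fin N, e.symm ((e univ).succAbove a) = e.symm ((e univ).succAbove b) → a = b :=
    fun a b h => Fin.succAbove_right_injective (e.symm.injective h)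
  have hCinj : ∀ a b : Fin N, e.symm ((e ∅).succAbove a) = e.symm ((e ∅).succAbove b) → a = b :=
    fun a b h => Fin.succAbove_right_injective (e.symm.injective h)
  obtain ⟨hpS, hq⟩ := htail
  have hTcard : T.card = n := by rw [hTu, Finset.card_univ, Fintype.card_fin]
  have hgap : S.card + 1 < T.card := by rw [hTcard, ← Finset.card_insert_of_notMem hpS]; exact hUn
  -- the orderings: `σ` enumerates `S` then `p`; `τ` is arbitrary (no high column is active)
  obtain ⟨σ₀, hσ₀⟩ := Grenet.exists_perm_prefix_image_eq S
  obtain ⟨σ, hσ, hltS, hσp⟩ := Grenet.exists_perm_prefix_image_insert hσ₀ hpS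
  obtain ⟨τ, hτ⟩ := Grenet.exists_perm_prefix_image_eq T
  -- the gap design
  set d : Fin n → Fin n := fun c => if (c : ℕ) ≤ S.card then σ c else τ c with hd
  set D : Fin n × Fin n → k := fun w =>
    if ((w.2 : ℕ) ≤ S.card ∨ T.card ≤ (w.2 : ℕ)) ∧ d w.2 = w.1 then 1 else 0 with hDdef
  have hD : ∀ p c : Fin n, D (p, c) =
      if (fun c : Fin n => (c : ℕ) ≤ S.card ∨ T.card ≤ (c : ℕ)) c ∧ d c = p then 1 else 0 :=
    fun _ _ => rfl
  have hd' : ∀ c : Fin n, d c = if (c : ℕ) ≤ S.card then σ c else τ c := fun _ => rfl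
  have hact : ∀ c : Fin n, (fun c : Fin n => (c : ℕ) ≤ S.card ∨ T.card ≤ (c : ℕ)) c ↔
      ((c : ℕ) ≤ S.card ∨ T.card ≤ (c : ℕ)) := fun _ => Iff.rfl
  -- the weight block of the tail entry, evaluated at the design
  have hblock := grenet_tangency_weightSplit e (fun j => (Pi.single (Sum.inl j) 1 : Fin n ⊕ Fin n → ℕ))
    (fun c => (Pi.single (Sum.inr c) 1 : Fin n ⊕ Fin n → ℕ)) hn hN A' htr
    ((∑ j₁ ∈ S, (Pi.single (Sum.inl j₁) 1 : Fin n ⊕ Fin n → ℕ)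
        + ∑ j₁ ∈ Tᶜ, (Pi.single (Sum.inl j₁) 1 : Fin n ⊕ Fin n → ℕ)) +
      (∑ c ∈ univ.filter (fun c : Fin n => (c : ℕ) < S.card), (Pi.single (Sum.inr c) 1 : Fin n ⊕ Fin n → ℕ)
        + ∑ c ∈ univ.filter (fun c : Fin n => T.card ≤ (c : ℕ)), (Pi.single (Sum.inr c) 1 : Fin n ⊕ Fin n → ℕ))
      + ((Pi.single (Sum.inl v.1) 1 : Fin n ⊕ Fin n → ℕ) + (Pi.single (Sum.inr v.2) 1 : Fin n ⊕ Fin n → ℕ)))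
  have h := congrArg (eval D) hblock
  rw [map_sum, map_zero] at h
  -- each term of the block: only the tail entry `(i, j, v)` survives
  have hterm : ∀ x ∈ (univ : Finset (Fin N × Fin N × (Fin n × Fin n))).filter (fun x =>
      ((∑ j₁ ∈ e.symm ((e univ).succAbove x.1), (Pi.single (Sum.inl j₁) 1 : Fin n ⊕ Fin n → ℕ)
          + ∑ j₁ ∈ (e.symm ((e ∅).succAbove x.2.1))ᶜ, (Pi.single (Sum.inl j₁) 1 : Fin n ⊕ Fin n → ℕ)) +
        (∑ c ∈ univ.filter (fun c : Fin n => (c : ℕ) < (e.symm ((e univ).succAbove x.1)).card),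
            (Pi.single (Sum.inr c) 1 : Fin n ⊕ Fin n → ℕ)
          + ∑ c ∈ univ.filter (fun c : Fin n => (e.symm ((e ∅).succAbove x.2.1)).card ≤ (c : ℕ)),
            (Pi.single (Sum.inr c) 1 : Fin n ⊕ Fin n → ℕ))
        + ((Pi.single (Sum.inl x.2.2.1) 1 : Fin n ⊕ Fin n → ℕ) + (Pi.single (Sum.inr x.2.2.2) 1 : Fin n ⊕ Fin n → ℕ)))
      = ((∑ j₁ ∈ S, (Pi.single (Sum.inl j₁) 1 : Fin n ⊕ Fin n → ℕ)
          + ∑ j₁ ∈ Tᶜ, (Pi.single (Sum.inl j₁) 1 : Fin n ⊕ Fin n → ℕ)) +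
        (∑ c ∈ univ.filter (fun c : Fin n => (c : ℕ) < S.card), (Pi.single (Sum.inr c) 1 : Fin n ⊕ Fin n → ℕ)
          + ∑ c ∈ univ.filter (fun c : Fin n => T.card ≤ (c : ℕ)), (Pi.single (Sum.inr c) 1 : Fin n ⊕ Fin n → ℕ))
        + ((Pi.single (Sum.inl v.1) 1 : Fin n ⊕ Fin n → ℕ) + (Pi.single (Sum.inr v.2) 1 : Fin n ⊕ Fin n → ℕ)))),
      eval D (C (A' x.2.2 x.1 x.2.1) *
          (perPoly (Fin n) k * (1 - Grenet.adj k n).adjugate (e.symm ((e ∅).succAbove x.2.1))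
              (e.symm ((e univ).succAbove x.1)) * X x.2.2
            - (1 - Grenet.adj k n).adjugate ∅ (e.symm ((e univ).succAbove x.1)) * X x.2.2
              * (1 - Grenet.adj k n).adjugate (e.symm ((e ∅).succAbove x.2.1)) univ))
        = -(A' x.2.2 x.1 x.2.1 * if x = (i, j, v) then 1 else 0) := by
    rintro ⟨i'', j'', v''⟩ hx
    have hw := (Finset.mem_filter.mp hx).2
    simp only at hw ⊢
    set S'' := e.symm ((e univ).succAbove i'') with hS''def
    set T'' := e.symm ((e ∅).succAbove j'') with hT''def
    -- the column weights
    have hcol : ∀ c, c < n → (if c < S''.card then 1 else 0) + (if T''.card ≤ c then 1 else 0)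
        + (if c = (v''.2 : ℕ) then 1 else 0)
        = (if c < S.card then 1 else 0) + (if T.card ≤ c then 1 else 0) + (if c = S.card then (1 : ℕ) else 0) := by
      intro c hc
      have h1 := congrFun hw (Sum.inr ⟨c, hc⟩)
      rw [weightE_apply_inr, weightE_apply_inr, ite_fin_eq_eq_ite_val_eq, ite_fin_eq_eq_ite_val_eq, hq] at h1
      simpa only [Fin.val_mk] using h1
    have hshape := gap_column_shape hgap hTcard.le ((Finset.card_le_univ T'').trans_eq (Fintype.card_fin n))
      v''.2.isLt hcol
    have hS''le : S''.card ≤ S.card + 1 := by rcases hshape with h' | h' <;> omega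
    have hT''ge : T.card ≤ T''.card := by rcases hshape with h' | h' <;> omega
    -- evaluate the term
    rw [map_mul, eval_C, map_sub, map_mul, map_mul, map_mul, map_mul,
      evalGap_perPoly k S.card T.card D d _ hD hact hgap hTcard.le, zero_mul, zero_mul, zero_sub, eval_X,
      evalGap_W_empty k σ τ S.card T.card D d _ hD hd' hact S'' hS''le,
      evalGap_W_univ k σ τ S.card T.card D d _ hD hd' hact (by omega) T'' hT''ge, mul_neg, neg_inj]
    have hDv : D v'' = if (((v''.2 : ℕ) ≤ S.card ∨ T.card ≤ (v''.2 : ℕ)) ∧ d v''.2 = v''.1) then 1 else 0 := rfl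
    rw [hDv, ite_mul_ite_mul_ite]
    suffices key : ((univ.filter fun c : Fin n => (c : ℕ) < S''.card).image σ = S'' ∧
        (((v''.2 : ℕ) ≤ S.card ∨ T.card ≤ (v''.2 : ℕ)) ∧ d v''.2 = v''.1) ∧
        (univ.filter fun c : Fin n => (c : ℕ) < T''.card).image τ = T'') ↔
        ((i'', j'', v'') = (i, j, v)) by
      by_cases hc : ((univ.filter fun c : Fin n => (c : ℕ) < S''.card).image σ = S'' ∧
          (((v''.2 : ℕ) ≤ S.card ∨ T.card ≤ (v''.2 : ℕ)) ∧ d v''.2 = v''.1) ∧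
          (univ.filter fun c : Fin n => (c : ℕ) < T''.card).image τ = T'')
      · rw [if_pos hc, if_pos (key.mp hc)]
      · rw [if_neg hc, if_neg fun h' => hc (key.mpr h')]
    -- identification of the surviving entry: the shape is tail-like (`|T| = n` excludes head-like)
    have hs : S''.card = S.card := by rcases hshape with h' | h' <;> omega
    have ht : T''.card = T.card := by rcases hshape with h' | h' <;> omega
    have hqq : (v''.2 : ℕ) = S.card := by rcases hshape with h' | h' <;> omega
    have hq2 : v''.2 = ⟨S.card, hltS⟩ := Fin.ext hqq
    have hdq : d v''.2 = v.1 := by rw [hd', if_pos (by omega), hq2, hσp]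
    constructor
    · rintro ⟨h1, ⟨-, h2⟩, h3⟩
      rw [hs, hσ] at h1
      rw [ht, hτ] at h3
      rw [hdq] at h2
      have hi : i'' = i := hRinj _ _ h1.symm
      have hj : j'' = j := hCinj _ _ h3.symm
      have hv : v'' = v := Prod.ext h2.symm (Fin.ext (by rw [hqq, hq]))
      rw [hi, hj, hv]
    · intro h1
      have hi : i'' = i := congrArg Prod.fst h1
      have hj : j'' = j := congrArg (fun x => x.2.1) h1
      have hv : v'' = v := congrArg (fun x => x.2.2) h1
      refine ⟨?_, ⟨Or.inl (by omega), by rw [hdq, hv]⟩, ?_⟩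
      · rw [hs, hσ, hS''def, hi]
      · rw [ht, hτ, hT''def, hj]
  rw [Finset.sum_congr rfl hterm, Finset.sum_neg_distrib, neg_eq_zero] at h
  -- the surviving entry
  have hxt : ((i, j, v) : Fin N × Fin N × (Fin n × Fin n)) ∈ (univ : Finset (Fin N × Fin N × (Fin n × Fin n))).filter (fun x =>
      ((∑ j₁ ∈ e.symm ((e univ).succAbove x.1), (Pi.single (Sum.inl j₁) 1 : Fin n ⊕ Fin n → ℕ)
          + ∑ j₁ ∈ (e.symm ((e ∅).succAbove x.2.1))ᶜ, (Pi.single (Sum.inl j₁) 1 : Fin n ⊕ Fin n → ℕ)) +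
        (∑ c ∈ univ.filter (fun c : Fin n => (c : ℕ) < (e.symm ((e univ).succAbove x.1)).card),
            (Pi.single (Sum.inr c) 1 : Fin n ⊕ Fin n → ℕ)
          + ∑ c ∈ univ.filter (fun c : Fin n => (e.symm ((e ∅).succAbove x.2.1)).card ≤ (c : ℕ)),
            (Pi.single (Sum.inr c) 1 : Fin n ⊕ Fin n → ℕ))
        + ((Pi.single (Sum.inl x.2.2.1) 1 : Fin n ⊕ Fin n → ℕ) + (Pi.single (Sum.inr x.2.2.2) 1 : Fin n ⊕ Fin n → ℕ)))
      = ((∑ j₁ ∈ S, (Pi.single (Sum.inl j₁) 1 : Fin n ⊕ Fin n → ℕ)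
          + ∑ j₁ ∈ Tᶜ, (Pi.single (Sum.inl j₁) 1 : Fin n ⊕ Fin n → ℕ)) +
        (∑ c ∈ univ.filter (fun c : Fin n => (c : ℕ) < S.card), (Pi.single (Sum.inr c) 1 : Fin n ⊕ Fin n → ℕ)
          + ∑ c ∈ univ.filter (fun c : Fin n => T.card ≤ (c : ℕ)), (Pi.single (Sum.inr c) 1 : Fin n ⊕ Fin n → ℕ))
        + ((Pi.single (Sum.inl v.1) 1 : Fin n ⊕ Fin n → ℕ) + (Pi.single (Sum.inr v.2) 1 : Fin n ⊕ Fin n → ℕ)))) :=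
    Finset.mem_filter.mpr ⟨Finset.mem_univ _, rfl⟩
  rw [Finset.sum_eq_single_of_mem _ hxt (fun x _ hx => by rw [if_neg hx, mul_zero]), if_pos rfl, mul_one] at h
  exact h

end BorderQ0

/-! ### Border case `S = ∅`: a lone head entry vanishes -/

section BorderP0

variable {k : Type*} [CommRing k] [IsDomain k] {n N : ℕ} (e : Finset (Fin n) ≃ Fin (N + 1))

omit [IsDomain k] in
/-- **Column weights in the block of a head entry with empty row vertex** (`1 ≤ t₀ < n`): if
`[c < s] + [t ≤ c] + [c = q] = [c < 0] + [t₀ + 1 ≤ c] + [c = t₀]` for all `c < n`, then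
`(s, t, q) = (0, t₀ + 1, t₀)`. [folklore] -/
theorem head_column_shape₀ {n t₀ s t q : ℕ} (ht₀ : 1 ≤ t₀) (ht₀n : t₀ < n) (ht : t ≤ n) (hq : q < n)
    (h : ∀ c, c < n → (if c < s then 1 else 0) + (if t ≤ c then 1 else 0) + (if c = q then 1 else 0)
      = (if c < 0 then 1 else 0) + (if t₀ + 1 ≤ c then 1 else 0) + (if c = t₀ then (1 : ℕ) else 0)) :
    s = 0 ∧ t = t₀ + 1 ∧ q = t₀ := by
  have h1 : s = 0 ∧ 1 ≤ t ∧ q ≠ 0 := by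
    have hc := h 0 (by omega)
    rw [if_neg (show ¬ (0 < 0) by omega), if_neg (show ¬ (t₀ + 1 ≤ 0) by omega),
      if_neg (show ¬ (0 = t₀) by omega)] at hc
    split_ifs at hc <;> omega
  have h2 : t₀ ≤ q ∧ q < t := by
    have hc := h q hq
    rw [if_pos (rfl : q = q), if_neg (show ¬ (q < 0) by omega)] at hc
    split_ifs at hc <;> omega
  have h3 : q = t₀ := by
    have hc := h t₀ ht₀n
    rw [if_neg (show ¬ (t₀ < 0) by omega), if_neg (show ¬ (t₀ + 1 ≤ t₀) by omega), if_pos (rfl : t₀ = t₀)] at hc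
    split_ifs at hc <;> omega
  refine ⟨h1.1, ?_, h3⟩
  by_cases h4 : t₀ + 1 < n
  · have hc := h (t₀ + 1) h4
    rw [if_neg (show ¬ (t₀ + 1 < 0) by omega), if_pos (le_refl (t₀ + 1)),
      if_neg (show ¬ (t₀ + 1 = t₀) by omega)] at hc
    split_ifs at hc <;> omega
  · omega

/-- **(D-P0).**  A head entry `(i, j, v)` (`v = (p, q)`, `p ∈ C j`, `|C j| = q + 1`) of a homogeneous
tangent direction at Grenet's pencil whose row vertex is `R i = ∅`, with `C j - p ≠ ∅`, vanishes:
`A'_v i j = 0` (its weight block, evaluated at the design of an ordering listing `C j - p` then `p` on the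
columns `≥ |C j| - 1`, all lower columns inactive, contains no other surviving entry).
[cite: Grenet2011, Thm. 1] -/
theorem grenet_gap_P0 (hn : n ≠ 0) (hN : 2 ^ n = N + 1)
    (A' : Fin n × Fin n → Matrix (Fin N) (Fin N) k)
    (htr : ((Grenet.repr k n e).adjugate * ∑ v, (X v : MvPolynomial (Fin n × Fin n) k) • (A' v).map C).trace = 0)
    {i j : Fin N} {v : Fin n × Fin n}
    (hhead : v.1 ∈ e.symm ((e ∅).succAbove j) ∧ (e.symm ((e ∅).succAbove j)).card = (v.2 : ℕ) + 1)
    (hS0 : e.symm ((e univ).succAbove i) = ∅) (hT0 : (e.symm ((e ∅).succAbove j)).erase v.1 ≠ ∅) :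
    A' v i j = 0 := by
  classical
  -- notation and bookkeeping
  set S := e.symm ((e univ).succAbove i) with hSdef
  set T' := e.symm ((e ∅).succAbove j) with hT'def
  set T := T'.erase v.1 with hTdef
  have hRinj : ∀ a b : Fin N, e.symm ((e univ).succAbove a) = e.symm ((e univ).succAbove b) → a = b :=
    fun a b h => Fin.succAbove_right_injective (e.symm.injective h)
  have hCinj : ∀ a b : Fin N, e.symm ((e ∅).succAbove a) = e.symm ((e ∅).succAbove b) → a = b :=
    fun a b h => Fin.succAbove_right_injective (e.symm.injective h)
  obtain ⟨hpT', hq⟩ := hhead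
  have hpT : v.1 ∉ T := Finset.notMem_erase _ _
  have hT'eq : T' = insert v.1 T := by rw [hTdef, Finset.insert_erase hpT']
  have hTcard : T.card = (v.2 : ℕ) := by
    have h1 := Finset.card_erase_of_mem hpT'
    rw [← hTdef] at h1
    omega
  have hT'card : T'.card = T.card + 1 := by omega
  have hTpos : 1 ≤ T.card := Finset.card_pos.mpr (Finset.nonempty_iff_ne_empty.mpr hT0)
  have hTn : T.card < n := hTcard ▸ v.2.isLt
  have hScard : S.card = 0 := by rw [hS0, Finset.card_empty]
  -- the ordering: `τ` enumerates `T` then `p`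
  obtain ⟨τ₀, hτ₀⟩ := Grenet.exists_perm_prefix_image_eq T
  obtain ⟨τ, hτ, hltT, hτp⟩ := Grenet.exists_perm_prefix_image_insert hτ₀ hpT
  have hτT' : (univ.filter fun c : Fin n => (c : ℕ) < T.card + 1).image τ = T' := by
    rw [Grenet.prefix_image_succ τ hltT, hτp, hτ, hT'eq]
  -- the design: columns `≥ |T|` active, filled by `τ`
  set D : Fin n × Fin n → k := fun w => if T.card ≤ (w.2 : ℕ) ∧ τ w.2 = w.1 then 1 else 0 with hDdef
  have hD : ∀ p c : Fin n, D (p, c) = if (fun c : Fin n => T.card ≤ (c : ℕ)) c ∧ τ c = p then 1 else 0 :=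
    fun _ _ => rfl
  -- the weight block of the head entry, evaluated at the design
  have hblock := grenet_tangency_weightSplit e (fun j => (Pi.single (Sum.inl j) 1 : Fin n ⊕ Fin n → ℕ))
    (fun c => (Pi.single (Sum.inr c) 1 : Fin n ⊕ Fin n → ℕ)) hn hN A' htr
    ((∑ j₁ ∈ S, (Pi.single (Sum.inl j₁) 1 : Fin n ⊕ Fin n → ℕ)
        + ∑ j₁ ∈ T'ᶜ, (Pi.single (Sum.inl j₁) 1 : Fin n ⊕ Fin n → ℕ)) +
      (∑ c ∈ univ.filter (fun c : Fin n => (c : ℕ) < S.card), (Pi.single (Sum.inr c) 1 : Fin n ⊕ Fin n → ℕ)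
        + ∑ c ∈ univ.filter (fun c : Fin n => T'.card ≤ (c : ℕ)), (Pi.single (Sum.inr c) 1 : Fin n ⊕ Fin n → ℕ))
      + ((Pi.single (Sum.inl v.1) 1 : Fin n ⊕ Fin n → ℕ) + (Pi.single (Sum.inr v.2) 1 : Fin n ⊕ Fin n → ℕ)))
  have h := congrArg (eval D) hblock
  rw [map_sum, map_zero] at h
  -- each term of the block: only the head entry `(i, j, v)` survives
  have hterm : ∀ x ∈ (univ : Finset (Fin N × Fin N × (Fin n × Fin n))).filter (fun x =>
      ((∑ j₁ ∈ e.symm ((e univ).succAbove x.1), (Pi.single (Sum.inl j₁) 1 : Fin n ⊕ Fin n → ℕ)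
          + ∑ j₁ ∈ (e.symm ((e ∅).succAbove x.2.1))ᶜ, (Pi.single (Sum.inl j₁) 1 : Fin n ⊕ Fin n → ℕ)) +
        (∑ c ∈ univ.filter (fun c : Fin n => (c : ℕ) < (e.symm ((e univ).succAbove x.1)).card),
            (Pi.single (Sum.inr c) 1 : Fin n ⊕ Fin n → ℕ)
          + ∑ c ∈ univ.filter (fun c : Fin n => (e.symm ((e ∅).succAbove x.2.1)).card ≤ (c : ℕ)),
            (Pi.single (Sum.inr c) 1 : Fin n ⊕ Fin n → ℕ))
        + ((Pi.single (Sum.inl x.2.2.1) 1 : Fin n ⊕ Fin n → ℕ) + (Pi.single (Sum.inr x.2.2.2) 1 : Fin n ⊕ Fin n → ℕ)))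
      = ((∑ j₁ ∈ S, (Pi.single (Sum.inl j₁) 1 : Fin n ⊕ Fin n → ℕ)
          + ∑ j₁ ∈ T'ᶜ, (Pi.single (Sum.inl j₁) 1 : Fin n ⊕ Fin n → ℕ)) +
        (∑ c ∈ univ.filter (fun c : Fin n => (c : ℕ) < S.card), (Pi.single (Sum.inr c) 1 : Fin n ⊕ Fin n → ℕ)
          + ∑ c ∈ univ.filter (fun c : Fin n => T'.card ≤ (c : ℕ)), (Pi.single (Sum.inr c) 1 : Fin n ⊕ Fin n → ℕ))
        + ((Pi.single (Sum.inl v.1) 1 : Fin n ⊕ Fin n → ℕ) + (Pi.single (Sum.inr v.2) 1 : Fin n ⊕ Fin n → ℕ)))),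
      eval D (C (A' x.2.2 x.1 x.2.1) *
          (perPoly (Fin n) k * (1 - Grenet.adj k n).adjugate (e.symm ((e ∅).succAbove x.2.1))
              (e.symm ((e univ).succAbove x.1)) * X x.2.2
            - (1 - Grenet.adj k n).adjugate ∅ (e.symm ((e univ).succAbove x.1)) * X x.2.2
              * (1 - Grenet.adj k n).adjugate (e.symm ((e ∅).succAbove x.2.1)) univ))
        = -(A' x.2.2 x.1 x.2.1 * if x = (i, j, v) then 1 else 0) := by
    rintro ⟨i'', j'', v''⟩ hx
    have hw := (Finset.mem_filter.mp hx).2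
    simp only at hw ⊢
    set S'' := e.symm ((e univ).succAbove i'') with hS''def
    set T'' := e.symm ((e ∅).succAbove j'') with hT''def
    -- the column weights force the head-like shape
    have hcol : ∀ c, c < n → (if c < S''.card then 1 else 0) + (if T''.card ≤ c then 1 else 0)
        + (if c = (v''.2 : ℕ) then 1 else 0)
        = (if c < 0 then 1 else 0) + (if T.card + 1 ≤ c then 1 else 0) + (if c = T.card then (1 : ℕ) else 0) := by
      intro c hc
      have h1 := congrFun hw (Sum.inr ⟨c, hc⟩)
      rw [weightE_apply_inr, weightE_apply_inr, ite_fin_eq_eq_ite_val_eq, ite_fin_eq_eq_ite_val_eq, hScard,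
        hT'card, ← hTcard] at h1
      simpa only [Fin.val_mk] using h1
    obtain ⟨hs, ht, hqq⟩ := head_column_shape₀ hTpos hTn ((Finset.card_le_univ T'').trans_eq (Fintype.card_fin n))
      v''.2.isLt hcol
    have hS''0 : S'' = ∅ := Finset.card_eq_zero.mp hs
    have hq2 : v''.2 = ⟨T.card, hltT⟩ := Fin.ext hqq
    -- evaluate the term
    have hper : eval D (perPoly (Fin n) k) = 0 :=
      evalDesign_perPoly_eq_zero k D τ (fun c : Fin n => T.card ≤ (c : ℕ)) hD ⟨0, by omega⟩
        (by simp only [Nat.le_zero]; omega)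
    have he1 : eval D ((1 - Grenet.adj k n).adjugate ∅ S'') = 1 := by
      rw [evalDesign_grenet_W_empty k D τ (fun c : Fin n => T.card ≤ (c : ℕ)) hD, if_pos]
      rw [hS''0]
      refine ⟨fun c hc => absurd hc (by simp), fun c c' hc => absurd hc (by simp), ?_⟩
      rw [Finset.card_empty, Finset.image_eq_empty]
      exact Finset.filter_false_of_mem fun c _ => Nat.not_lt_zero _
    have he3 : eval D ((1 - Grenet.adj k n).adjugate T'' univ) =
        if (univ.filter fun c : Fin n => (c : ℕ) < T''.card).image τ = T'' then 1 else 0 := by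
      rw [evalDesign_grenet_W_univ k D τ (fun c : Fin n => T.card ≤ (c : ℕ)) hD]
      have hT''n : T''.card ≤ n := (Finset.card_le_univ T'').trans_eq (Fintype.card_fin n)
      have key : (∀ c : Fin n, T''.card ≤ (c : ℕ) → τ c ∉ T'') ↔
          (univ.filter fun c : Fin n => (c : ℕ) < T''.card).image τ = T'' := by
        constructor
        · intro h'
          symm
          apply Finset.eq_of_subset_of_card_le
          · intro x hx'
            rw [Grenet.mem_prefix_image]
            by_contra hlt
            exact h' (τ.symm x) (not_lt.mp hlt) (by rwa [Equiv.apply_symm_apply])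
          · rw [Grenet.card_prefix_image τ hT''n]
        · intro h' c hc hcT
          rw [← h', Grenet.mem_prefix_image, Equiv.symm_apply_apply] at hcT
          omega
      by_cases hc : (univ.filter fun c : Fin n => (c : ℕ) < T''.card).image τ = T''
      · rw [if_pos hc, if_pos]
        exact ⟨fun c hc' => ⟨show T.card ≤ (c : ℕ) by omega, key.mpr hc c hc'⟩,
          fun c c' _ _ hcc => τ.injective hcc⟩
      · rw [if_neg hc, if_neg]
        rintro ⟨h1, -⟩
        exact hc (key.mp fun c hc' => (h1 c hc').2)
    rw [map_mul, eval_C, map_sub, map_mul, map_mul, map_mul, map_mul, hper, zero_mul, zero_mul, zero_sub,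
      eval_X, he1, one_mul, he3, mul_neg, neg_inj]
    have hDv : D v'' = if (T.card ≤ (v''.2 : ℕ) ∧ τ v''.2 = v''.1) then 1 else 0 := rfl
    rw [hDv]
    suffices key : ((T.card ≤ (v''.2 : ℕ) ∧ τ v''.2 = v''.1) ∧
        (univ.filter fun c : Fin n => (c : ℕ) < T''.card).image τ = T'') ↔ ((i'', j'', v'') = (i, j, v)) by
      by_cases hc : ((T.card ≤ (v''.2 : ℕ) ∧ τ v''.2 = v''.1) ∧
          (univ.filter fun c : Fin n => (c : ℕ) < T''.card).image τ = T'')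
      · rw [if_pos hc.1, if_pos hc.2, if_pos (key.mp hc), mul_one]
      · rw [if_neg fun h' => hc (key.mpr h')]
        rcases not_and_or.mp hc with h' | h'
        · rw [if_neg h', zero_mul]
        · rw [if_neg h', mul_zero]
    -- identification of the surviving entry
    have hdq : τ v''.2 = v.1 := by rw [hq2, hτp]
    constructor
    · rintro ⟨⟨-, h2⟩, h3⟩
      rw [ht, hτT'] at h3
      rw [hdq] at h2
      have hi : i'' = i := hRinj _ _ (hS''0.trans hS0.symm)
      have hj : j'' = j := hCinj _ _ h3.symm
      have hv : v'' = v := Prod.ext h2.symm (Fin.ext (by rw [hqq, hTcard]))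
      rw [hi, hj, hv]
    · intro h1
      have hj : j'' = j := congrArg (fun x => x.2.1) h1
      have hv : v'' = v := congrArg (fun x => x.2.2) h1
      refine ⟨⟨by omega, by rw [hdq, hv]⟩, ?_⟩
      rw [ht, hτT', hT''def, hj]
  rw [Finset.sum_congr rfl hterm, Finset.sum_neg_distrib, neg_eq_zero] at h
  -- the surviving entry
  have hxh : ((i, j, v) : Fin N × Fin N × (Fin n × Fin n)) ∈ (univ : Finset (Fin N × Fin N × (Fin n × Fin n))).filter (fun x =>
      ((∑ j₁ ∈ e.symm ((e univ).succAbove x.1), (Pi.single (Sum.inl j₁) 1 : Fin n ⊕ Fin n → ℕ)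
          + ∑ j₁ ∈ (e.symm ((e ∅).succAbove x.2.1))ᶜ, (Pi.single (Sum.inl j₁) 1 : Fin n ⊕ Fin n → ℕ)) +
        (∑ c ∈ univ.filter (fun c : Fin n => (c : ℕ) < (e.symm ((e univ).succAbove x.1)).card),
            (Pi.single (Sum.inr c) 1 : Fin n ⊕ Fin n → ℕ)
          + ∑ c ∈ univ.filter (fun c : Fin n => (e.symm ((e ∅).succAbove x.2.1)).card ≤ (c : ℕ)),
            (Pi.single (Sum.inr c) 1 : Fin n ⊕ Fin n → ℕ))
        + ((Pi.single (Sum.inl x.2.2.1) 1 : Fin n ⊕ Fin n → ℕ) + (Pi.single (Sum.inr x.2.2.2) 1 : Fin n ⊕ Fin n → ℕ)))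
      = ((∑ j₁ ∈ S, (Pi.single (Sum.inl j₁) 1 : Fin n ⊕ Fin n → ℕ)
          + ∑ j₁ ∈ T'ᶜ, (Pi.single (Sum.inl j₁) 1 : Fin n ⊕ Fin n → ℕ)) +
        (∑ c ∈ univ.filter (fun c : Fin n => (c : ℕ) < S.card), (Pi.single (Sum.inr c) 1 : Fin n ⊕ Fin n → ℕ)
          + ∑ c ∈ univ.filter (fun c : Fin n => T'.card ≤ (c : ℕ)), (Pi.single (Sum.inr c) 1 : Fin n ⊕ Fin n → ℕ))
        + ((Pi.single (Sum.inl v.1) 1 : Fin n ⊕ Fin n → ℕ) + (Pi.single (Sum.inr v.2) 1 : Fin n ⊕ Fin n → ℕ)))) :=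
    Finset.mem_filter.mpr ⟨Finset.mem_univ _, rfl⟩
  rw [Finset.sum_eq_single_of_mem _ hxh (fun x _ hx => by rw [if_neg hx, mul_zero]), if_pos rfl, mul_one] at h
  exact h

end BorderP0


end Summit.ValiantsHypothesis.Theorems.RigidityForcesSymmetry.GrenetGauge
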